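import Literature.NumberTheory.Sieve.Maynard2016Theorem1
import Literature.NumberTheory.Sieve.Maynard2016Lemma8Bounded
import Literature.NumberTheory.Sieve.Maynard2016HistDensityProof
import Literature.NumberTheory.Sieve.Maynard2016MainChain
import Literature.NumberTheory.Sieve.Maynard2016Lemma3Proof
import Literature.NumberTheory.Sieve.Maynard2016Lemma2Proof

/-!
# Maynard (2016), large gaps between primes — the remaining named facts of the ladder, discharged

Trunk: AntSieve / parity (Maynard 2016 large-gaps ladder).

J. Maynard, *Large gaps between primes*, Ann. of Math. 183 (2016) = arXiv:1408.5110.  The tree proves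
the per-tuple form of Lemma 7 (`lemma7Tuple_holds`, file `Maynard2016Theorem1`), Lemma 6
(`maynard2016_lemma6_holds`), Lemmas 2 and 3 (`lemma2_holds`, `lemma3_holds`), the densities of §8
(`ScaledDensityBdd_holds`, …) and every implication of the printed chain
Lemma 7 ⇒ GPY measures (§4) ⇒ Proposition 5′ ⇒ Proposition 5 ⇒ the covering statement of §2.  The
named facts `Lemma7Pos`, `Lemma7Main`, `Lemma7`, `GPYMeasures`, `Proposition5Prime`, `Proposition5`
and `CoveringTheorem` of the statement files were nevertheless still WITHOUT their `_holds`; this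
leaf records the seven one-line derivations (D-0026 bookkeeping: proof terms are existing theorems
of the tree composed; no statement, definition or attribute is edited; no new named fact).

## References

* J. Maynard, *Large gaps between primes*, Ann. of Math. (2) 183 (2016), 915–933; arXiv:1408.5110,
  §2, §3, §4, Proposition 5, Lemma 7, Theorem 1. [Maynard2016LargeGaps]
-/

namespace Literature.NumberTheory.Sieve

namespace Maynard2016

/-- **Lemma 7 of Maynard (2016), positivity form (display (6.32))**, unconditionally: the per-tuple
estimates `lemma7Tuple_holds` summed over the tuple (`lemma7Pos_of_tuple`).
[cite: Maynard2016LargeGaps, Lemma 7 (proof, displays (6.22)–(6.32))] -/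
theorem Lemma7Pos_holds : Literature.NumberTheory.Sieve.Maynard2016.Lemma7Pos :=
  lemma7Pos_of_tuple lemma7Tuple_holds

/-- **Lemma 7 of Maynard (2016), main-term form**, unconditionally (`lemma7Main_of_pos`).
[cite: Maynard2016LargeGaps, Lemma 7 (proof, displays (6.22)–(6.31))] -/
theorem Lemma7Main_holds : Literature.NumberTheory.Sieve.Maynard2016.Lemma7Main :=
  lemma7Main_of_pos Lemma7Pos_holds

/-- **Lemma 7 of Maynard (2016)** as stated (`Σ_q μ_{m,q}(p₀) ≥ …`), unconditionally: Lemma 6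
(`maynard2016_lemma6_holds`) and the positivity form (`lemma7_of_lemma6_pos`).
[cite: Maynard2016LargeGaps, Lemma 7] -/
theorem Lemma7_holds : Literature.NumberTheory.Sieve.Maynard2016.Lemma7 :=
  lemma7_of_lemma6_pos maynard2016_lemma6_holds Lemma7Pos_holds

/-- **The GPY probability measures of §4** exist, unconditionally: Lemma 7 and the bounded scaled
density of §8 (`ScaledDensityBdd_holds`, via `gpyMeasures_of_lemma7_scaledDensityBdd`).
[cite: Maynard2016LargeGaps, §4 (first paragraph)] -/
theorem GPYMeasures_holds : Literature.NumberTheory.Sieve.Maynard2016.GPYMeasures :=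
  gpyMeasures_of_lemma7_scaledDensityBdd Lemma7_holds ScaledDensityBdd_holds

/-- **Proposition 5′ of Maynard (2016)** (§3, first paragraph), unconditionally
(`proposition5Prime_of_GPYMeasures`). [cite: Maynard2016LargeGaps, §3 (first paragraph)] -/
theorem Proposition5Prime_holds : Literature.NumberTheory.Sieve.Maynard2016.Proposition5Prime :=
  proposition5Prime_of_GPYMeasures GPYMeasures_holds

/-- **Proposition 5 of Maynard (2016)** (the key proposition), unconditionally: Proposition 5′ and
Lemma 3 (`proposition5_of_proposition5Prime`, `lemma3_holds`).
[cite: Maynard2016LargeGaps, Proposition 5] -/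
theorem Proposition5_holds : Literature.NumberTheory.Sieve.Maynard2016.Proposition5 :=
  proposition5_of_proposition5Prime Proposition5Prime_holds lemma3_holds

/-- **The covering statement of §2** (residue classes `a_p (mod p)`, `p ≤ x`, covering `[1, U]`),
unconditionally: Lemmas 2, 3 and Proposition 5 (`coveringTheorem_of_lemmas`).
[cite: Maynard2016LargeGaps, §2, proof of Theorem 1 (last sentence)] -/
theorem CoveringTheorem_holds : Literature.NumberTheory.Sieve.Maynard2016.CoveringTheorem :=
  coveringTheorem_of_lemmas lemma2_holds lemma3_holds Proposition5_holds

end Maynard2016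

end Literature.NumberTheory.Sieve
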